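import Literature.Geometry.Lorentzian.EventHorizonGenerators
import Literature.Geometry.Lorentzian.HypersurfaceCorrespondingBoundary
import Literature.Geometry.Lorentzian.VisibleIncompleteNullRay
import Literature.Geometry.Lorentzian.NullRayNonImprisonment
import Literature.Geometry.Lorentzian.CauchyDevelopmentAcausal
import Summits.FinalStateConjecture.FinalStateConjecture.Theorems.PhotonSphereChannelsTameHullDefs
import Summits.FinalStateConjecture.FinalStateConjecture.Theorems.PhotonSphereChannelsTameCensorshipMaximalGeodesicEndless
import HarnessLib
/-!
# Route PhotonSphereChannels · crux `ChannelsResolveTameDevelopmentsR` (stmt-FinalStateConjecture-17430) ·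
# line `dark-future-exactness`: HORIZON GENERATOR PATHS EXIST through every horizon point

Helper file (`--supports stmt-FinalStateConjecture-17430`, registered stub `stub_horizonGeneratorPaths`) for line
`dark-future-exactness`. Stubs A(c) (`OuterHullShadowed`), P, K, N1, T of that line quantify over HORIZON GENERATOR PATHS
`IsHorizonPath 𝒟 γ` (continuous `γ : ℝ → horizonOf 𝒟 = 𝒟.eventHorizonOf (outerRegion 𝒟)`, in `closure outer`, causally
monotone, future-escaping); the line card lists "existence + future-escape of horizon generators" as an open sub-bet of stub A.
This file settles it from causal theory alone (no tameness, vacuum or maximality): through EVERY point `h` of `horizonOf 𝒟`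
passes such a path (`exists_horizonPath_through`: the conjuncts of `IsHorizonPath` verbatim, plus `γ 0 = h`).
Ingredients: `horizonOf 𝒟 ⊆ 𝒟.futureEventHorizon = ∂I⁻(completeNullRayRegion)` (`EventHorizon.lean`), with equality on
`I⁺(ι X)`; the intrinsic horizon is future null geodesically ruled (Hawking–Ellis 1973, Lemma 6.3.2 / §9.2, p. 319;
`CauchyDevelopment.isFutureNullGeodesicallyRuled_futureEventHorizon`, `EventHorizonGenerators.lean`); a generator is future
endless (`TameCensorshipUnwind.stub_maximalGeodesic_isFutureEndless` / `isFutureEndless_Ici_of_isGeodesicOn`), so it leaves the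
compact sets `J⁺(h) ∩ J⁻(K)` (non-imprisonment, O'Neill 1983, Ch. 14, Lemma 13; Hawking–Ellis Prop. 6.6.6); strictly later
generator points lie in `I⁺(ι X)` (acausality of the data hypersurface); reparametrise by `[0, ∞)`, constant for `s ≤ 0`.
-/

noncomputable section

-- every `Summit.FinalStateConjecture.FinalStateConjecture.…` name repeats the summit = sub-problem segment (D-0017 layout)
set_option linter.dupNamespace false

open Set Filter Function TopologicalSpace
open scoped Topology Manifold ContDiff

namespace Summit.FinalStateConjecture.FinalStateConjecture.Theorems.ChannelsResolveTameDevelopmentsR.HorizonGenerators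

open Literature.Geometry.Lorentzian
open Summit.FinalStateConjecture.FinalStateConjecture.Theorems.TameHull

variable {X : Type} [TopologicalSpace X] [ChartedSpace E3 X] [IsManifold (𝓡 3) ∞ X]
  [T2Space X] [SecondCountableTopology X] [ConnectedSpace X] {D : InitialDataSet (𝓡 3) X}

/-! ### §1 The outer region of the route is the intrinsic outer region `J⁺(ι X) ∩ I⁻(𝓘⁺)` -/

omit [T2Space X] [SecondCountableTopology X] in
/-- The route's outer region (`TameHull.outerRegion`, verbatim the `let outer` of the crux) IS the intrinsic
`DataEmbedding.outerRegion = J⁺(ι X) ∩ visibleRegion` of `EventHorizon.lean`. [folklore] -/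
theorem outerRegion_eq_outerRegion (𝒟 : VacuumCauchyDevelopment D) [𝒟.metric.HasLeviCivita] :
    outerRegion 𝒟 = 𝒟.toDataEmbedding.outerRegion :=
  rfl

/-! ### §2 Causal-theoretic lemmas on a Cauchy development -/

section Causal

variable {n : ℕ} {Y : Type} [TopologicalSpace Y] [ChartedSpace (EuclideanSpace ℝ (Fin n)) Y]
  [IsManifold (𝓡 n) ∞ Y] [ConnectedSpace Y] {D' : InitialDataSet (𝓡 n) Y}

/-- **`J⁺(x) ∩ J⁻(C)` is compact for compact `C`** in a Cauchy development (Hawking–Ellis 1973, Prop. 6.6.6; time dual of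
`CauchyDevelopment.isCompact_causalFuture_inter_causalPast_of_isCompact`: cover `C` by finitely many `I⁻(cᵢ⁺)`; a closed subset
of finitely many compact causal diamonds `J⁺(x) ∩ J⁻(cᵢ⁺)`). [cite: HawkingEllis1973CUP, §6.6, Prop. 6.6.6] -/
theorem isCompact_causalFuture_inter_causalPast_of_isCompact' (𝒟 : CauchyDevelopment D')
    (x : 𝒟.carrier) {C : Set 𝒟.carrier} (hC : IsCompact C) :
    IsCompact (𝒟.metric.causalFuture 𝒟.timeOrientation {x} ∩
      𝒟.metric.causalPast 𝒟.timeOrientation C) := by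
  classical
  have hn1 : (1 : ℕ∞ω) ≤ ∞ := WithTop.coe_le_coe.mpr le_top
  have hn2 : (2 : ℕ∞ω) ≤ ∞ := WithTop.coe_le_coe.mpr le_top
  have hG := 𝒟.isGloballyHyperbolic
  have hf : ∀ c : 𝒟.carrier, ∃ y, y ∈ 𝒟.metric.chronologicalFuture 𝒟.timeOrientation {c} := fun c ↦
    LorentzianMetric.exists_mem_chronologicalFuture_singleton hn2 c
  choose f hf using hf
  have hcov : ∀ c ∈ C, 𝒟.metric.chronologicalPast 𝒟.timeOrientation {f c} ∈ 𝓝 c := fun c _ ↦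
    (LorentzianMetric.isOpen_chronologicalPast_of_boundaryless _ _ {f c}).mem_nhds
      (LorentzianMetric.mem_chronologicalPast_of_mem_chronologicalFuture (hf c))
  obtain ⟨t, -, htcov⟩ := hC.elim_nhds_subcover
    (fun c ↦ 𝒟.metric.chronologicalPast 𝒟.timeOrientation {f c}) hcov
  have hsub : 𝒟.metric.causalFuture 𝒟.timeOrientation {x} ∩ 𝒟.metric.causalPast 𝒟.timeOrientation C ⊆
      ⋃ c ∈ t, (𝒟.metric.causalFuture 𝒟.timeOrientation {x} ∩
        𝒟.metric.causalPast 𝒟.timeOrientation {f c}) := by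
    rintro y ⟨hyx, hyC⟩
    rw [LorentzianMetric.causalPast, LorentzianMetric.causalFuture_eq_biUnion] at hyC
    simp only [mem_iUnion, exists_prop] at hyC
    obtain ⟨c, hcC, hyc⟩ := hyC
    obtain ⟨c', hc't, hcc'⟩ : ∃ c' ∈ t, c ∈ 𝒟.metric.chronologicalPast 𝒟.timeOrientation {f c'} := by
      have h := htcov hcC
      simp only [mem_iUnion, exists_prop] at h
      exact h
    refine mem_iUnion₂.2 ⟨c', hc't, hyx, ?_⟩
    have h3 : y ∈ 𝒟.metric.chronologicalFuture 𝒟.timeOrientation.reverse {f c'} :=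
      mem_chronologicalFuture_of_mem_causalFuture_of_mem_chronologicalFuture 𝒟.timeOrientation.reverse hn1
        hcc' hyc
    exact LorentzianMetric.chronologicalFuture_subset_causalFuture _ _ _ h3
  have hclosed : IsClosed (𝒟.metric.causalFuture 𝒟.timeOrientation {x} ∩
      𝒟.metric.causalPast 𝒟.timeOrientation C) :=
    (𝒟.isClosed_causalFuture_singleton x).inter
      ((LorentzianMetric.IsGloballyHyperbolic.reverse hG).isClosed_causalFuture_of_isCompact hn2 hC)
  refine (t.finite_toSet.isCompact_biUnion fun c _ ↦ 𝒟.isCompact_causalDiamond x (f c)).of_isClosed_subset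
    hclosed hsub

/-- **Cofinal parametrisation of the tail of an open interval by `[0, ∞)`**: for an open interval `dom ∋ t₀` there is `σ`,
continuous and monotone on `[0, ∞)`, `σ 0 = t₀`, with values in `dom ∩ [t₀, ∞)`, eventually above every `t ∈ dom`
(`σ s = t₀ + s` if `dom` is unbounded above, `sup dom − (sup dom − t₀)/(1 + s)` otherwise). [folklore] -/
theorem exists_cofinal_param {dom : Set ℝ} (hopen : IsOpen dom) (hoc : dom.OrdConnected) {t₀ : ℝ}
    (ht₀ : t₀ ∈ dom) :
    ∃ σ : ℝ → ℝ, ContinuousOn σ (Ici 0) ∧ MonotoneOn σ (Ici 0) ∧ σ 0 = t₀ ∧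
      (∀ s, 0 ≤ s → σ s ∈ dom ∧ t₀ ≤ σ s) ∧ ∀ t ∈ dom, ∀ᶠ s in atTop, t ≤ σ s := by
  by_cases hb : BddAbove dom
  · -- bounded: `σ s = β - (β - t₀) / (1 + s)`, `β = sup dom > t₀`
    set β := sSup dom with hβ_def
    have hlt : ∀ t ∈ dom, t < β := fun t ht ↦ by
      obtain ⟨ε, hε, hεsub⟩ := Metric.isOpen_iff.1 hopen t ht
      have h1 : t + ε / 2 ∈ dom := hεsub (by
        rw [Metric.mem_ball, Real.dist_eq, add_sub_cancel_left, abs_of_pos (by linarith)]; linarith)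
      exact lt_of_lt_of_le (by linarith) (le_csSup hb h1)
    have ht₀β : t₀ < β := hlt t₀ ht₀
    refine ⟨fun s ↦ β - (β - t₀) / (1 + s), ?_, ?_, ?_, ?_, ?_⟩
    · refine ContinuousOn.sub continuousOn_const (ContinuousOn.div continuousOn_const
        (continuousOn_const.add continuousOn_id) fun s hs ↦ ?_)
      have : (0 : ℝ) ≤ s := hs
      positivity
    · intro s hs s' hs' hss'
      have h0 : (0 : ℝ) ≤ s := hs
      have h1 : 0 < 1 + s := by linarith
      have h2 : 0 < 1 + s' := by have : (0 : ℝ) ≤ s' := hs'; linarith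
      have : (β - t₀) / (1 + s') ≤ (β - t₀) / (1 + s) :=
        div_le_div_of_nonneg_left (by linarith) h1 (by linarith)
      linarith
    · simp
    · intro s hs
      have h1 : 0 < 1 + s := by linarith
      have hle : t₀ ≤ β - (β - t₀) / (1 + s) := by
        rw [le_sub_iff_add_le, ← le_sub_iff_add_le', div_le_iff₀ h1]
        nlinarith
      have hltβ : β - (β - t₀) / (1 + s) < β := by
        have : 0 < (β - t₀) / (1 + s) := div_pos (by linarith) h1
        linarith
      obtain ⟨d, hd, hσd⟩ := exists_lt_of_lt_csSup ⟨t₀, ht₀⟩ hltβ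
      exact ⟨hoc.out ht₀ hd ⟨hle, hσd.le⟩, hle⟩
    · intro t ht
      have htβ : t < β := hlt t ht
      refine Filter.eventually_atTop.2 ⟨(β - t₀) / (β - t), fun s hs ↦ ?_⟩
      have hpos : 0 < β - t := by linarith
      have h0 : 0 ≤ (β - t₀) / (β - t) := div_nonneg (by linarith) hpos.le
      have h1 : 0 < 1 + s := by linarith
      have h2 : (β - t₀) / (1 + s) ≤ β - t := by
        rw [div_le_iff₀ h1]
        have h3 : (β - t₀) / (β - t) * (β - t) = β - t₀ := div_mul_cancel₀ _ hpos.ne'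
        nlinarith
      linarith
  · -- unbounded: `σ s = t₀ + s`
    refine ⟨fun s ↦ t₀ + s, (continuous_const.add continuous_id).continuousOn,
      fun s _ s' _ hss' ↦ by linarith, by simp, fun s hs ↦ ⟨?_, by linarith⟩, fun t _ ↦ ?_⟩
    · obtain ⟨d, hd, hsd⟩ := not_bddAbove_iff.1 hb (t₀ + s)
      exact hoc.out ht₀ hd ⟨by linarith, hsd.le⟩
    · exact Filter.eventually_atTop.2 ⟨t - t₀, fun s hs ↦ by linarith⟩

end Causal

/-! ### §3 `horizonOf 𝒟` versus the intrinsic event horizon `𝒟.futureEventHorizon` -/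

section Horizon

variable (𝒟 : VacuumCauchyDevelopment D) [𝒟.metric.HasLeviCivita]

omit [T2Space X] [SecondCountableTopology X] in
/-- `I⁻(outer region) ⊆ visibleRegion` (the visible region is a past set containing the outer region). [folklore] -/
theorem chronologicalPast_outerRegion_subset_visibleRegion :
    𝒟.metric.chronologicalPast 𝒟.timeOrientation (outerRegion 𝒟) ⊆ 𝒟.toDataEmbedding.visibleRegion :=
  fun _ hx ↦ 𝒟.toDataEmbedding.isPastSet_visibleRegion
    (LorentzianMetric.chronologicalFuture_mono inter_subset_right hx)

omit [T2Space X] [SecondCountableTopology X] in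
/-- **To the causal future of the data, visible events lie in `I⁻(outer region)`**: if `x ∈ J⁺(ι X)` and `x ≪ y`, `y` on a
complete ray, a point `z` with `x ≪ z ≪ y` is an outer point above `x` (push-up). [folklore] -/
theorem mem_chronologicalPast_outerRegion {x : 𝒟.carrier}
    (hxJ : x ∈ 𝒟.metric.causalFuture 𝒟.timeOrientation (range 𝒟.embed))
    (hxV : x ∈ 𝒟.toDataEmbedding.visibleRegion) :
    x ∈ 𝒟.metric.chronologicalPast 𝒟.timeOrientation (outerRegion 𝒟) := by
  have hn1 : (1 : ℕ∞ω) ≤ ∞ := WithTop.coe_le_coe.mpr le_top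
  obtain ⟨p, δ, s, hδ, hs, hx⟩ := hxV
  obtain ⟨y, hy, γ, a, b, hab, hγ, hγa, hγb⟩ := hx
  -- the midpoint `z` of the (reversed-orientation) timelike curve from `y` to `x`
  set m : ℝ := (a + b) / 2 with hm_def
  have ham : a < m := by rw [hm_def]; linarith
  have hmb : m < b := by rw [hm_def]; linarith
  have hzy : γ m ∈ 𝒟.metric.chronologicalPast 𝒟.timeOrientation {y} :=
    ⟨y, rfl, γ, a, m, ham, hγ.mono (Icc_subset_Icc_right hmb.le), hγa, rfl⟩
  have hxz : x ∈ 𝒟.metric.chronologicalPast 𝒟.timeOrientation {γ m} :=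
    ⟨γ m, rfl, γ, m, b, hmb, hγ.mono (Icc_subset_Icc_left ham.le), rfl, hγb⟩
  have hzx : γ m ∈ 𝒟.metric.chronologicalFuture 𝒟.timeOrientation {x} :=
    LorentzianMetric.mem_chronologicalFuture_of_mem_chronologicalPast hxz
  -- `z` is an outer point
  have hzouter : γ m ∈ outerRegion 𝒟 := by
    refine ⟨?_, p, δ, s, hδ, hs, ?_⟩
    · -- `J⁺(ι X) ∋ x ≪ z`
      rw [LorentzianMetric.causalFuture_eq_biUnion] at hxJ ⊢
      simp only [mem_iUnion, exists_prop] at hxJ ⊢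
      obtain ⟨s₀, hs₀, hxs₀⟩ := hxJ
      exact ⟨s₀, hs₀, LorentzianMetric.chronologicalFuture_subset_causalFuture _ _ _
        (LorentzianMetric.mem_chronologicalFuture_of_mem_causalFuture hn1 hxs₀ hzx)⟩
    · exact LorentzianMetric.chronologicalFuture_mono (singleton_subset_iff.2 hy) hzy
  exact LorentzianMetric.chronologicalFuture_mono (singleton_subset_iff.2 hzouter)
    (LorentzianMetric.mem_chronologicalPast_of_mem_chronologicalFuture hzx)

omit [T2Space X] [SecondCountableTopology X] in
/-- **Every point of `horizonOf 𝒟 = 𝒟.eventHorizonOf (outerRegion 𝒟)` lies on the intrinsic event horizon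
`𝒟.futureEventHorizon = ∂ visibleRegion`.** [folklore] -/
theorem mem_futureEventHorizon_of_mem_eventHorizonOf {h : 𝒟.carrier}
    (hh : h ∈ 𝒟.toCauchyDevelopment.eventHorizonOf (outerRegion 𝒟)) :
    h ∈ 𝒟.toDataEmbedding.futureEventHorizon := by
  obtain ⟨hfr, hJ⟩ := hh
  have hWopen : IsOpen (𝒟.metric.chronologicalPast 𝒟.timeOrientation (outerRegion 𝒟)) :=
    LorentzianMetric.isOpen_chronologicalPast_of_boundaryless _ _ _
  have hVopen : IsOpen 𝒟.toDataEmbedding.visibleRegion := 𝒟.toDataEmbedding.isOpen_visibleRegion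
  change h ∈ frontier 𝒟.toDataEmbedding.visibleRegion
  rw [hVopen.frontier_eq]
  rw [hWopen.frontier_eq] at hfr
  refine ⟨closure_mono (chronologicalPast_outerRegion_subset_visibleRegion 𝒟) hfr.1, fun hV ↦ hfr.2 ?_⟩
  exact mem_chronologicalPast_outerRegion 𝒟 hJ hV

omit [T2Space X] [SecondCountableTopology X] in
/-- **Conversely, to the chronological future of the data every point of the intrinsic event horizon lies on
`horizonOf 𝒟` and in the closure of the outer region.** [folklore] -/
theorem mem_eventHorizonOf_of_mem_futureEventHorizon {x : 𝒟.carrier}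
    (hx : x ∈ 𝒟.toDataEmbedding.futureEventHorizon)
    (hxI : x ∈ 𝒟.metric.chronologicalFuture 𝒟.timeOrientation (range 𝒟.embed)) :
    x ∈ 𝒟.toCauchyDevelopment.eventHorizonOf (outerRegion 𝒟) ∧ x ∈ closure (outerRegion 𝒟) := by
  have hWopen : IsOpen (𝒟.metric.chronologicalPast 𝒟.timeOrientation (outerRegion 𝒟)) :=
    LorentzianMetric.isOpen_chronologicalPast_of_boundaryless _ _ _
  have hVopen : IsOpen 𝒟.toDataEmbedding.visibleRegion := 𝒟.toDataEmbedding.isOpen_visibleRegion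
  have hUopen : IsOpen (𝒟.metric.chronologicalFuture 𝒟.timeOrientation (range 𝒟.embed)) :=
    LorentzianMetric.isOpen_chronologicalFuture_of_boundaryless _ _ _
  have hxJ : x ∈ 𝒟.metric.causalFuture 𝒟.timeOrientation (range 𝒟.embed) :=
    LorentzianMetric.chronologicalFuture_subset_causalFuture _ _ _ hxI
  change x ∈ frontier 𝒟.toDataEmbedding.visibleRegion at hx
  rw [hVopen.frontier_eq] at hx
  have hUV : 𝒟.metric.chronologicalFuture 𝒟.timeOrientation (range 𝒟.embed) ∩ 𝒟.toDataEmbedding.visibleRegion ⊆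
      𝒟.metric.chronologicalPast 𝒟.timeOrientation (outerRegion 𝒟) := fun y hy ↦
    mem_chronologicalPast_outerRegion 𝒟 (LorentzianMetric.chronologicalFuture_subset_causalFuture _ _ _ hy.1) hy.2
  have hUV' : 𝒟.metric.chronologicalFuture 𝒟.timeOrientation (range 𝒟.embed) ∩ 𝒟.toDataEmbedding.visibleRegion ⊆
      outerRegion 𝒟 := fun y hy ↦
    ⟨LorentzianMetric.chronologicalFuture_subset_causalFuture _ _ _ hy.1, hy.2⟩
  have hxcl : x ∈ closure (𝒟.metric.chronologicalFuture 𝒟.timeOrientation (range 𝒟.embed) ∩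
      𝒟.toDataEmbedding.visibleRegion) := hUopen.inter_closure ⟨hxI, hx.1⟩
  refine ⟨⟨?_, hxJ⟩, closure_mono hUV' hxcl⟩
  rw [hWopen.frontier_eq]
  exact ⟨closure_mono hUV hxcl, fun hW ↦ hx.2 (chronologicalPast_outerRegion_subset_visibleRegion 𝒟 hW)⟩

end Horizon

/-! ### §4 Horizon generator paths through every horizon point -/

omit [T2Space X] [SecondCountableTopology X] in
/-- **Through every point of `horizonOf 𝒟` passes a horizon generator path** — the conjuncts of `IsHorizonPath 𝒟 γ` of line
`dark-future-exactness`, verbatim, plus `γ 0 = h`: continuous `γ : ℝ → 𝒟.eventHorizonOf (outerRegion 𝒟)`, in `closure outer`,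
causally monotone, future-escaping. It is the null geodesic generator of the intrinsic event horizon through `h`
(`CauchyDevelopment.isFutureNullGeodesicallyRuled_futureEventHorizon`; Hawking–Ellis 1973, §9.2, p. 319: the generators of the
event horizon have no future endpoints), reparametrised by `[0, ∞)` (`exists_cofinal_param`) and constant for `s ≤ 0`; future
escape is non-imprisonment of the future-endless generator in the compact sets `J⁺(h) ∩ J⁻(K)`; strictly later generator points
lie in `I⁺(ι X)` (`J⁺(ι X) ⊆ ι(X) ∪ I⁺(ι X)`, acausality of `ι(X)`, no closed causal curves), where `horizonOf 𝒟` and the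
intrinsic horizon agree, and `h` lies in `closure outer` as their limit. No tameness, vacuum or maximality hypothesis.
[cite: HawkingEllis1973CUP, §9.2 (p. 319)] -/
theorem exists_horizonPath_through (𝒟 : VacuumCauchyDevelopment D) [𝒟.metric.HasLeviCivita]
    {h : 𝒟.carrier} (hh : h ∈ 𝒟.toCauchyDevelopment.eventHorizonOf (outerRegion 𝒟)) :
    ∃ γ : ℝ → 𝒟.carrier, γ 0 = h ∧ Continuous γ ∧
      (∀ s, γ s ∈ 𝒟.toCauchyDevelopment.eventHorizonOf (outerRegion 𝒟)) ∧
      (∀ s, γ s ∈ closure (outerRegion 𝒟)) ∧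
      (∀ s s' : ℝ, s ≤ s' → γ s' ∈ 𝒟.metric.causalFuture 𝒟.timeOrientation {γ s}) ∧
      ∀ K : Set 𝒟.carrier, IsCompact K →
        ∀ᶠ s in atTop, γ s ∉ 𝒟.metric.causalPast 𝒟.timeOrientation K := by
  have hn1 : (1 : ℕ∞ω) ≤ ∞ := WithTop.coe_le_coe.mpr le_top
  have hn2 : (2 : ℕ∞ω) ≤ ∞ := WithTop.coe_le_coe.mpr le_top
  haveI := LorentzianMetric.contMDiffCovariantDerivative_leviCivita_one 𝒟.metric
  haveI : Fact ((1 : ℕ∞ω) ≤ ∞) := ⟨hn1⟩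
  -- the generator of the intrinsic event horizon through `h`
  have hhH : h ∈ 𝒟.toDataEmbedding.futureEventHorizon := mem_futureEventHorizon_of_mem_eventHorizonOf 𝒟 hh
  obtain ⟨μ, dom, t₀, hmax, ht₀, hμt₀, hnull, hfd, hstay⟩ :=
    𝒟.toCauchyDevelopment.isFutureNullGeodesicallyRuled_futureEventHorizon h hhH
  have hμcurve : 𝒟.metric.IsFutureCausalCurveOn 𝒟.timeOrientation μ dom :=
    LorentzianMetric.isFutureCausalCurveOn_of_isMaximalGeodesicOn_of_isNull 𝒟.timeOrientation hmax ht₀ hnull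
      hfd
  have hμcont : ContinuousOn μ dom := fun t ht ↦ (hμcurve.continuousAt ht).continuousWithinAt
  -- later points of the generator: above `h`, hence in `I⁺(ι X)`, on the horizon
  have hlater : ∀ u ∈ dom, t₀ ≤ u → μ u ∈ 𝒟.metric.causalFuture 𝒟.timeOrientation {h} := fun u hu htu ↦ by
    have h1 := (hμcurve.mono (hmax.2.1.out ht₀ hu)).apply_right_mem_causalFuture_apply (left_mem_Icc.2 htu)
    rwa [hμt₀] at h1
  -- strictly later points of the generator lie in `I⁺(ι X)`: `J⁺(ι X) ⊆ ι(X) ∪ I⁺(ι X)`, and a later point on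
  -- `ι(X)` would equal `h` (acausality), closing a causal loop
  have hhJ : h ∈ 𝒟.metric.causalFuture 𝒟.timeOrientation (range 𝒟.embed) := hh.2
  have hpush : ∀ {x}, h ∈ 𝒟.metric.chronologicalFuture 𝒟.timeOrientation (range 𝒟.embed) →
      x ∈ 𝒟.metric.causalFuture 𝒟.timeOrientation {h} →
      x ∈ 𝒟.metric.chronologicalFuture 𝒟.timeOrientation (range 𝒟.embed) := fun {x} hhI hx ↦ by
    rw [LorentzianMetric.chronologicalFuture_eq_biUnion] at hhI ⊢
    simp only [mem_iUnion, exists_prop] at hhI ⊢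
    obtain ⟨s₀, hs₀, hhs₀⟩ := hhI
    exact ⟨s₀, hs₀, mem_chronologicalFuture_of_mem_causalFuture_of_mem_chronologicalFuture 𝒟.timeOrientation
      hn1 hhs₀ hx⟩
  have hIu : ∀ u ∈ dom, t₀ < u → μ u ∈ 𝒟.metric.chronologicalFuture 𝒟.timeOrientation (range 𝒟.embed) := by
    intro u hu htu
    rcases 𝒟.toCauchyDevelopment.causalFuture_range_embed_subset_union hhJ with hhS | hhI
    · have hxJ : μ u ∈ 𝒟.metric.causalFuture 𝒟.timeOrientation (range 𝒟.embed) := by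
        rw [← LorentzianMetric.causalFuture_causalFuture_eq hn2 (range 𝒟.embed)]
        exact LorentzianMetric.causalFuture_mono (singleton_subset_iff.mpr hhJ) (hlater u hu htu.le)
      rcases 𝒟.toCauchyDevelopment.causalFuture_range_embed_subset_union hxJ with hxS | hxI
      · exfalso
        have heq : μ u = h := 𝒟.toCauchyDevelopment.eq_of_mem_causalFuture_range_embed h hhS (μ u) hxS
          (hlater u hu htu.le)
        exact 𝒟.isCausallyWellBehaved μ t₀ u htu (hμcurve.mono (hmax.2.1.out ht₀ hu)) (by rw [hμt₀, heq])
      · exact hxI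
    · exact hpush hhI (hlater u hu htu.le)
  -- points of the generator from `t₀` on: on `horizonOf 𝒟` and in the closure of the outer region
  have hpt : ∀ u ∈ dom, t₀ ≤ u → μ u ∈ 𝒟.toCauchyDevelopment.eventHorizonOf (outerRegion 𝒟) ∧
      μ u ∈ closure (outerRegion 𝒟) := by
    intro u hu htu
    rcases htu.eq_or_lt with heq | hlt
    · rw [← heq, hμt₀]
      refine ⟨hh, ?_⟩
      -- `h` is the limit of the later generator points, which lie in `closure outer`
      obtain ⟨ε, hε, hεsub⟩ := Metric.isOpen_iff.1 hmax.1 t₀ ht₀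
      have hIoo : Ioo t₀ (t₀ + ε) ⊆ dom ∩ Ioi t₀ := fun v hv ↦
        ⟨hεsub (by rw [Metric.mem_ball, Real.dist_eq, abs_of_pos (by linarith [hv.1])]; linarith [hv.2]), hv.1⟩
      have hcl : t₀ ∈ closure (dom ∩ Ioi t₀) := closure_mono hIoo (by
        rw [closure_Ioo (by linarith : t₀ ≠ t₀ + ε)]; exact left_mem_Icc.2 (by linarith))
      have hcw : ContinuousWithinAt μ (dom ∩ Ioi t₀) t₀ := (hμcont t₀ ht₀).mono inter_subset_left
      have hmem := hcw.mem_closure_image hcl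
      rw [hμt₀] at hmem
      refine closure_closure (X := 𝒟.carrier) ▸ closure_mono ?_ hmem
      rintro _ ⟨v, ⟨hv, htv⟩, rfl⟩
      exact (mem_eventHorizonOf_of_mem_futureEventHorizon 𝒟 (hstay v hv (le_of_lt htv)) (hIu v hv htv)).2
    · exact mem_eventHorizonOf_of_mem_futureEventHorizon 𝒟 (hstay u hu htu) (hIu u hu hlt)
  -- the parametrisation
  obtain ⟨σ, hσcont, hσmono, hσ0, hσdom, hσcof⟩ := exists_cofinal_param hmax.1 hmax.2.1 ht₀
  set γ : ℝ → 𝒟.carrier := fun s ↦ μ (σ (max s 0)) with hγ_def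
  have hinner : Continuous fun s : ℝ ↦ σ (max s 0) :=
    hσcont.comp_continuous (continuous_id.max continuous_const) fun s ↦ mem_Ici.2 (le_max_right s 0)
  have hmem : ∀ s : ℝ, σ (max s 0) ∈ dom ∧ t₀ ≤ σ (max s 0) := fun s ↦ hσdom _ (le_max_right _ _)
  refine ⟨γ, ?_, ?_, ?_, ?_, ?_, ?_⟩
  · simp [hγ_def, hσ0, hμt₀]
  · exact hμcont.comp_continuous hinner fun s ↦ (hmem s).1
  · exact fun s ↦ (hpt _ (hmem s).1 (hmem s).2).1
  · exact fun s ↦ (hpt _ (hmem s).1 (hmem s).2).2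
  · intro s s' hss'
    have hle : σ (max s 0) ≤ σ (max s' 0) :=
      hσmono (mem_Ici.2 (le_max_right s 0)) (mem_Ici.2 (le_max_right s' 0)) (max_le_max hss' le_rfl)
    exact (hμcurve.mono (hmax.2.1.out (hmem s).1 (hmem s').1)).apply_right_mem_causalFuture_apply
      (left_mem_Icc.2 hle)
  · intro K hK
    -- the compact set `J⁺(h) ∩ J⁻(K)` is eventually left by the future-endless generator
    have hC := isCompact_causalFuture_inter_causalPast_of_isCompact' 𝒟.toCauchyDevelopment h hK
    have hoc : (dom ∩ Ici t₀).OrdConnected := hmax.2.1.inter ordConnected_Ici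
    have hvel : velocity (𝓡 4) μ t₀ ≠ 0 := hnull.2
    have hend : IsFutureEndless μ (dom ∩ Ici t₀) := by
      by_cases hb : BddAbove dom
      · exact PhotonSphereChannels.TameCensorshipUnwind.stub_maximalGeodesic_isFutureEndless 𝒟.toSpacetime μ dom
          t₀ hmax hb ht₀ hvel
      · have hIci : Ici t₀ ⊆ dom := fun u hu ↦ by
          obtain ⟨d, hd, hud⟩ := not_bddAbove_iff.1 hb u
          exact hmax.2.1.out ht₀ hd ⟨hu, hud.le⟩
        have heq : dom ∩ Ici t₀ = Ici t₀ := inter_eq_right.2 hIci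
        rw [heq]
        refine 𝒟.metric.toPseudoRiemannianMetric.isFutureEndless_Ici_of_isGeodesicOn hn2
          (hmax.isGeodesicOn.mono hIci) fun u hu ↦ ?_
        exact (IsGeodesicOn.isNull_and_isFutureDirected_velocity 𝒟.metric 𝒟.timeOrientation hmax.1 hmax.2.1
          hmax.isGeodesicOn ht₀ hnull hfd (hIci hu)).1.2
    obtain ⟨t₁, ht₁, hout⟩ := LorentzianMetric.IsStronglyCausal.exists_forall_notMem hn2
      𝒟.toCauchyDevelopment.isStronglyCausal hC hoc (hμcurve.mono inter_subset_left) hend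
    have hev1 : ∀ᶠ s : ℝ in atTop, t₁ ≤ σ s := hσcof t₁ ht₁.1
    have hev2 : ∀ᶠ s : ℝ in atTop, 0 ≤ s := Filter.eventually_ge_atTop 0
    filter_upwards [hev1, hev2] with s hs1 hs2
    have hs0 : max s 0 = s := max_eq_left hs2
    intro hK'
    refine hout (σ (max s 0)) ⟨(hmem s).1, (hmem s).2⟩ (by rwa [hs0]) ⟨hlater _ (hmem s).1 (hmem s).2, ?_⟩
    exact hK'

/-- **Registered stub `stub_horizonGeneratorPaths` of stmt-FinalStateConjecture-17430** (self-contained restatement of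
`exists_horizonPath_through` for the `--supports` gate): for every admissible-type data manifold, every vacuum Cauchy
development `𝒟` and every point `h` of `𝒟.eventHorizonOf (outerRegion 𝒟)` (the hypothesis `h ∈ I⁺(ι X)` of the
registered text is not needed and not used), a horizon generator path through `h` exists (the conjuncts of
`IsHorizonPath` of line `dark-future-exactness`). [cite: HawkingEllis1973CUP, §9.2 (p. 319)] -/
theorem stub_horizonGeneratorPaths :
    ∀ (X : Type) [TopologicalSpace X] [ChartedSpace E3 X] [IsManifold (𝓡 3) ∞ X] [T2Space X]
      [SecondCountableTopology X] [ConnectedSpace X] (D : InitialDataSet (𝓡 3) X)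
      (𝒟 : VacuumCauchyDevelopment D) [𝒟.metric.HasLeviCivita] (h : 𝒟.carrier),
      h ∈ 𝒟.toCauchyDevelopment.eventHorizonOf (outerRegion 𝒟) →
      h ∈ 𝒟.metric.chronologicalFuture 𝒟.timeOrientation (Set.range 𝒟.embed) →
      ∃ γ : ℝ → 𝒟.carrier, γ 0 = h ∧ Continuous γ ∧
        (∀ s, γ s ∈ 𝒟.toCauchyDevelopment.eventHorizonOf (outerRegion 𝒟)) ∧
        (∀ s, γ s ∈ closure (outerRegion 𝒟)) ∧
        (∀ s s' : ℝ, s ≤ s' → γ s' ∈ 𝒟.metric.causalFuture 𝒟.timeOrientation {γ s}) ∧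
        ∀ K : Set 𝒟.carrier, IsCompact K →
          ∀ᶠ s in Filter.atTop, γ s ∉ 𝒟.metric.causalPast 𝒟.timeOrientation K :=
  fun _ _ _ _ _ _ _ _ 𝒟 _ _ hh _ ↦ exists_horizonPath_through 𝒟 hh

end Summit.FinalStateConjecture.FinalStateConjecture.Theorems.ChannelsResolveTameDevelopmentsR.HorizonGenerators

end
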